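import Literature.AlgebraicGeometry.Deformation.T1Lifting
import Mathlib.RingTheory.MvPolynomial.Ideal
import Mathlib.RingTheory.Ideal.Quotient.Operations
import Mathlib.RingTheory.MvPowerSeries.Inverse
import Mathlib.RingTheory.MvPowerSeries.Order
import Mathlib.RingTheory.MvPowerSeries.Trunc
import Mathlib.RingTheory.Artinian.Ring
import HarnessLib

/-!
# Smoothness from curvilinear liftings, and the T¹-lifting theorem for pro-representable functors

[FantechiManetti1998ObstructionCalculus, Lemma 5.6] (J. Algebra 202 (1998), p. 561): «Let `R ∈ Ârt_k`. Then the
following are equivalent: (i) the functor `h_R` is smooth (hence `R` is a power series algebra); (ii) `h_R` has no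
curvilinear obstructions; (iii) there exists `N₀ ∈ ℕ` such that the map `h_R(k[t]/t^{N+1}) → h_R(k[t]/t^N)` is
surjective for `N ≥ N₀`.» — «The only nontrivial implication is (iii) ⇒ (i)», proved there for
`R = P/I`, `P = k[[x_1, …, x_n]]`, `I ⊂ 𝔪_P²`, by WEIGHTS on the monomials occurring in `I`: positive weights
`a_1, …, a_n` are chosen so that the minimal weight `b` over all monomials of `I` is attained at a single exponent
`J₀`; the curve `c : x_i ↦ t^{a_i}` then kills `I` modulo `t^b` but `c(I) ⊄ (t^{b+1})`, and since `I ⊂ 𝔪²` no lift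
of `c` modulo `t^{b+1}` can kill `I` either — contradicting (iii) at `N = b ≥ N₀`. No hypothesis on the field `k`.

This file proves (iii) ⇒ (i) twice, with the conclusion (i) read as `I = 0` (and packages (i) ⟺ (iii) as
`powerSeries_ideal_eq_bot_iff_points_map_i_surjective`):
* `powerSeries_ideal_eq_bot_of_points_map_i_surjective` — THE PRINTED SETTING: `P = k[[x_1, …, x_n]]`
  (`MvPowerSeries (Fin n) k`), `I ⊆ 𝔪_P²` with `𝔪_P` the maximal ideal, `h_R` the functor of points of `R = P/I` on
  `Art_k` (`ArtinFunctor.points`, Schlessinger's `h_R`); every `R ∈ Ârt_k` is such a `P/I` by Cohen's structure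
  theorem (that identification is not formalised here);
* `ideal_eq_bot_of_points_map_i_surjective` — the same for ALGEBRAIC presentations `P = k[x_1, …, x_n]`
  (polynomial ring), `I ⊆ (x_1, …, x_n)²`, whose proof needs no power-series bookkeeping.
The proof is the printed one, with the «easy exercise in convex geometry» replaced by an explicit weight
`a_i = m·Mⁿ + Mⁱ` (`m` = least degree of a monomial of `I`, `M = m + 1`), whose minimum over the monomials of `I` is
unique by uniqueness of base-`M` digits (`T1Lifting.exists_weights`). For power series two standard facts about
finitely many variables are proved on the way: the weighted curve `x_i ↦ t^{a_i}` is a `k`-algebra map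
`k[[x]] → A_N` (`T1Lifting.exists_curve`, through `MvPowerSeries.truncTotal`), and a `k`-algebra map `k[[x]] → A` whose
values on the variables generate a nilpotent ideal is computed on a polynomial truncation
(`T1Lifting.algHom_eq_zero_of_coeff_eq_zero`: a series with no monomials of degree `< M` is `∑_{|d| = M} x^d h_d`).
The converse direction (i) ⇒ «`h_R` smooth» is `points_mvPowerSeries_map_surjective` / `points_mvPolynomial_map_surjective`
(the functor of points of `k[[x_1, …, x_n]]`, resp. `k[x_1, …, x_n]`, lifts along every surjection of `Art_k`); on the
way, [FantechiManetti1998ObstructionCalculus, p. 559] «to give a local morphism from `P = k[[x_1, …, x_n]]` to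
`S ∈ Ârt_k` is equivalent to choosing `f_1, …, f_n ∈ 𝔪_S` and requiring that `x_i ↦ f_i`» becomes, for `S ∈ Art_k`:
every `k`-algebra map `P → S` is local on the variables (`T1Lifting.algHom_X_mem_maximalIdeal`, so the tree's
`ArtinFunctor.points (P/I)` is Schlessinger's `h_{P/I}`), two such maps agreeing on the variables are equal
(`T1Lifting.mvPowerSeries_algHom_ext`), and any `f_i` in a nilpotent ideal are the values of one
(`T1Lifting.exists_algHom_of_pow_eq_bot`). The primary behind Lemma 5.6 (i)'s parenthesis («hence `R` is a power
series algebra»; [FantechiManetti1998ObstructionCalculus, Prop. 5.3]: «classical results of Schlessinger») is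
[Schlessinger1968, Prop. 2.5 (i), p. 211]: «Let `R → S` be a morphism in `Ĉ`. Then `h_S → h_R` is smooth if and only
if `S` is a power series ring over `R`.» — typed here at `R = k` for PRESENTED `S = P/I`, `I ⊆ 𝔪_P²`, with
smoothness in the form of [Schlessinger1968, Def. 2.2] (lifting along every surjection of `Art_k`) and «power series
ring» read as `I = 0`: `powerSeries_ideal_eq_bot_iff_points_smooth`.

Combined with the (H4) case of the T¹-lifting theorem already in the tree
(`ArtinFunctor.map_i_succ_surjective_of_t1Lifting`, [FantechiManetti1999T1Lifting, p. 3]) this gives KAWAMATA'S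
T¹-LIFTING THEOREM FOR PRO-REPRESENTABLE FUNCTORS ([FantechiManetti1999T1Lifting, p. 1, l. 20–24]: «In [Kaw1]
Kawamata extended the definition of T¹-lifting to an arbitrary functor, and proved theorem A under the additional
assumption that `F` be prorepresentable»; Theorem A: «Let `F` be a deformation functor. If `F` satisfies the
T¹-lifting condition and `char k = 0`, then `F` is smooth.»): in characteristic zero, if the functor of points of
`R = k[[x_1, …, x_n]]/I`, `I ⊆ 𝔪²`, has the T¹-lifting property, then `I = 0`, i.e. `R` is a power series ring
(`powerSeries_ideal_eq_bot_of_t1Lifting`; polynomial form `ideal_eq_bot_of_t1Lifting`).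

HONEST SCOPE: statements about the functor of points of `k[[x]]/I` or `k[x]/I` as an abstract functor of Artin rings;
no sheaf, complex, Hodge locus or semiregularity map is instantiated here; «smooth» is rendered as `I = 0` (for the
functor of points of the power series / polynomial ring itself, lifting along surjections is
`points_mvPowerSeries_map_surjective` / `points_mvPolynomial_map_surjective`).

## References
* [FantechiManetti1998ObstructionCalculus] B. Fantechi, M. Manetti, Obstruction calculus for functors of Artin rings I,
  J. Algebra 202 (1998) 541–576: Lemma 5.2, Lemma 5.6 (pp. 559–561), Cor. 6.4, Cor. 6.15.
* [FantechiManetti1999T1Lifting] B. Fantechi, M. Manetti, On the T¹-lifting theorem, J. Algebraic Geom. 8 (1999)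
  31–39: Thm. A (p. 1), p. 3 l. 3–4 («Arguing as in [Kaw1] it is sufficient to prove that for every integer `m ≥ 1`
  `F(A_{m+1}) → F(A_m)` is surjective»).
* [Kawamata1992UnobstructedDeformations] Y. Kawamata, Unobstructed deformations — a remark on a paper of Z. Ran,
  J. Algebraic Geom. 1 (1992) 183–190, Thm. 1 (with the Erratum, J. Algebraic Geom. 6 (1997) 803–804).
-/

universe u

open MvPolynomial
open scoped Pointwise

namespace Literature.AlgebraicGeometry.Deformation

namespace T1Lifting

/-! ### Base-`M` digits (the «easy exercise in convex geometry» made explicit) -/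

/-- Peeling off the lowest digit: `∑_{i<n+1} J_i Mⁱ = J_0 + M · ∑_{i<n} J_{i+1} Mⁱ`. [folklore] -/
private theorem digits_succ (M n : ℕ) (J : Fin (n + 1) → ℕ) :
    ∑ i, J i * M ^ (i : ℕ) = J 0 + M * ∑ i : Fin n, J i.succ * M ^ (i : ℕ) := by
  rw [Fin.sum_univ_succ, Fin.val_zero, pow_zero, mul_one, Finset.mul_sum]
  congr 1
  exact Finset.sum_congr rfl fun i _ => by rw [Fin.val_succ, pow_succ]; ring

/-- Digit vectors with entries `< M` have value `< Mⁿ`. [folklore] -/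
private theorem digits_lt (M : ℕ) : ∀ (n : ℕ) (J : Fin n → ℕ), (∀ i, J i < M) →
    ∑ i, J i * M ^ (i : ℕ) < M ^ n
  | 0, J, _ => by simp
  | n + 1, J, hJ => by
    rw [digits_succ, pow_succ]
    have ih := digits_lt M n (fun i => J i.succ) (fun i => hJ i.succ)
    have h0 := hJ 0
    set S := ∑ i : Fin n, J i.succ * M ^ (i : ℕ)
    calc J 0 + M * S < M + M * S := by omega
      _ = M * (S + 1) := by ring
      _ ≤ M * M ^ n := Nat.mul_le_mul_left _ ih
      _ = M ^ n * M := mul_comm _ _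

/-- Uniqueness of base-`M` digits. [folklore] -/
private theorem digits_inj (M : ℕ) : ∀ (n : ℕ) (J J' : Fin n → ℕ), (∀ i, J i < M) → (∀ i, J' i < M) →
    ∑ i, J i * M ^ (i : ℕ) = ∑ i, J' i * M ^ (i : ℕ) → J = J'
  | 0, J, J', _, _, _ => funext fun i => Fin.elim0 i
  | n + 1, J, J', hJ, hJ', h => by
    rw [digits_succ, digits_succ] at h
    have h0 : J 0 = J' 0 := by
      have := congrArg (· % M) h
      simpa [Nat.add_mul_mod_self_left, Nat.mod_eq_of_lt (hJ 0), Nat.mod_eq_of_lt (hJ' 0)] using this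
    have hM : 0 < M := lt_of_le_of_lt (Nat.zero_le _) (hJ 0)
    have htail : (fun i : Fin n => J i.succ) = fun i => J' i.succ := by
      refine digits_inj M n _ _ (fun i => hJ i.succ) (fun i => hJ' i.succ) ?_
      rw [h0] at h
      exact Nat.eq_of_mul_eq_mul_left hM (Nat.add_left_cancel h)
    funext i
    exact Fin.cases (motive := fun i => J i = J' i) h0 (fun j => by simpa using congrFun htail j) i

/-- THE WEIGHTS of [FantechiManetti1998ObstructionCalculus, proof of Lemma 5.6]: «there exist rational positive numbers
`a_1, …, a_n, b` such that `C ⊂ {J | ∑ a_i j_i ≥ b}` and `C ∩ {J | ∑ a_i j_i = b} = {J₀}`», for any set `C` of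
nonzero exponent vectors — here with natural weights `a_i ≥ 1` and `b` larger than any prescribed `L` (the printed
«Choose `N ∈ ℕ` such that `A_i = a_i N` and `B = bN` are all integers, and `B ≥ N₀`»). Construction: `m` = least
degree in `C`, `M = m + 1`, `a_i = m Mⁿ + Mⁱ`, so `∑ a_i J_i = m Mⁿ |J| + (digits of J)`; then scale by `L + 1`.
[cite: FantechiManetti1998ObstructionCalculus, Lemma 5.6] -/
theorem exists_weights {n : ℕ} (C : Set (Fin n →₀ ℕ)) (hne : C.Nonempty)
    (h0 : (0 : Fin n →₀ ℕ) ∉ C) (L : ℕ) :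
    ∃ (a : Fin n → ℕ) (b : ℕ) (J₀ : Fin n →₀ ℕ), J₀ ∈ C ∧ (∀ i, 1 ≤ a i) ∧ L < b ∧
      (∑ i, a i * J₀ i) = b ∧
      ∀ J ∈ C, b ≤ ∑ i, a i * J i ∧ ((∑ i, a i * J i) = b → J = J₀) := by
  classical
  -- `m` = the least degree of an element of `C`
  have hdeg : ∃ d, ∃ J ∈ C, (∑ i, J i) = d := let ⟨J, hJ⟩ := hne; ⟨_, J, hJ, rfl⟩
  obtain ⟨m, ⟨J₁, hJ₁C, hJ₁m⟩, hmin⟩ : ∃ m, (∃ J ∈ C, (∑ i, J i) = m) ∧ ∀ J ∈ C, m ≤ (∑ i, J i) :=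
    ⟨Nat.find hdeg, Nat.find_spec hdeg, fun J hJ => Nat.find_min' hdeg ⟨J, hJ, rfl⟩⟩
  have hle : ∀ (J : Fin n →₀ ℕ) (i : Fin n), J i ≤ (∑ i, J i) := fun J i =>
    Finset.single_le_sum (f := fun j => J j) (fun j _ => Nat.zero_le (J j)) (Finset.mem_univ i)
  have hm1 : 1 ≤ m := by
    have hJ₁0 : J₁ ≠ 0 := fun h => h0 (h ▸ hJ₁C)
    obtain ⟨i, hi⟩ : ∃ i, J₁ i ≠ 0 := DFunLike.ne_iff.1 hJ₁0
    rw [← hJ₁m]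
    exact le_trans (Nat.one_le_iff_ne_zero.2 hi) (hle J₁ i)
  -- `M = m + 1` bounds the entries of the degree-`m` exponents
  set M := m + 1 with hM
  have hlt : ∀ J : Fin n →₀ ℕ, (∑ i, J i) = m → ∀ i, J i < M := fun J hJ i => by
    have := hle J i
    omega
  -- the weight `a_i = m Mⁿ + Mⁱ` and its value `m Mⁿ |J| + dig J`
  set a₀ : Fin n → ℕ := fun i => m * M ^ n + M ^ (i : ℕ) with ha₀
  have hw : ∀ J : Fin n →₀ ℕ, ∑ i, a₀ i * J i = m * M ^ n * (∑ i, J i) + (∑ i, J i * M ^ (i : ℕ)) := fun J => by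
    simp only [ha₀, Finset.mul_sum, ← Finset.sum_add_distrib]
    exact Finset.sum_congr rfl fun i _ => by ring
  -- `b₀` = least digit value among the degree-`m` elements of `C`, attained at `J₀`
  have hB : ∃ b, ∃ J ∈ C, (∑ i, J i) = m ∧ (∑ i, J i * M ^ (i : ℕ)) = b := ⟨_, J₁, hJ₁C, hJ₁m, rfl⟩
  obtain ⟨b₀, ⟨J₀, hJ₀C, hJ₀m, hJ₀b⟩, hbmin⟩ :
      ∃ b₀, (∃ J ∈ C, (∑ i, J i) = m ∧ (∑ i, J i * M ^ (i : ℕ)) = b₀) ∧ ∀ J ∈ C, (∑ i, J i) = m → b₀ ≤ (∑ i, J i * M ^ (i : ℕ)) :=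
    ⟨Nat.find hB, Nat.find_spec hB, fun J hJ hJm => Nat.find_min' hB ⟨J, hJ, hJm, rfl⟩⟩
  have hb₀lt : b₀ < M ^ n := by
    have := digits_lt M n J₀ (hlt J₀ hJ₀m)
    rwa [hJ₀b] at this
  have hMn : M ^ n ≤ m * M ^ n := Nat.le_mul_of_pos_left _ hm1
  -- the unscaled conclusion
  have key : ∀ J ∈ C, m * M ^ n * m + b₀ ≤ ∑ i, a₀ i * J i ∧
      ((∑ i, a₀ i * J i) = m * M ^ n * m + b₀ → J = J₀) := by
    intro J hJ
    rw [hw J]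
    rcases (hmin J hJ).eq_or_lt with hJm | hJm
    · have hJm' : (∑ i, J i) = m := hJm.symm
      rw [hJm']
      refine ⟨Nat.add_le_add_left (hbmin J hJ hJm') _, fun h => ?_⟩
      have hd : (∑ i, J i * M ^ (i : ℕ)) = (∑ i, J₀ i * M ^ (i : ℕ)) := by rw [hJ₀b]; exact Nat.add_left_cancel h
      exact DFunLike.coe_injective (digits_inj M n J J₀ (hlt J hJm') (hlt J₀ hJ₀m) hd)
    · have hlt' : m * M ^ n * m + b₀ < m * M ^ n * (∑ i, J i) + (∑ i, J i * M ^ (i : ℕ)) :=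
        calc m * M ^ n * m + b₀ < m * M ^ n * m + M ^ n := Nat.add_lt_add_left hb₀lt _
          _ ≤ m * M ^ n * m + m * M ^ n := Nat.add_le_add_left hMn _
          _ = m * M ^ n * (m + 1) := by ring
          _ ≤ m * M ^ n * (∑ i, J i) := Nat.mul_le_mul_left _ hJm
          _ ≤ m * M ^ n * (∑ i, J i) + (∑ i, J i * M ^ (i : ℕ)) := Nat.le_add_right _ _
      exact ⟨hlt'.le, fun h => absurd h hlt'.ne'⟩
  have hJ₀w : ∑ i, a₀ i * J₀ i = m * M ^ n * m + b₀ := by rw [hw J₀, hJ₀m, hJ₀b]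
  have hb₀pos : 1 ≤ m * M ^ n * m + b₀ :=
    le_trans (le_trans hm1 (Nat.le_mul_of_pos_left _ (Nat.mul_pos hm1 (Nat.pow_pos (by omega)))))
      (Nat.le_add_right _ _)
  -- scale by `L + 1`
  have hsc : ∀ J : Fin n →₀ ℕ, ∑ i, (L + 1) * a₀ i * J i = (L + 1) * ∑ i, a₀ i * J i := fun J => by
    rw [Finset.mul_sum]
    exact Finset.sum_congr rfl fun i _ => by ring
  refine ⟨fun i => (L + 1) * a₀ i, (L + 1) * (m * M ^ n * m + b₀), J₀, hJ₀C, fun i => ?_, ?_, ?_,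
    fun J hJ => ⟨?_, fun h => ?_⟩⟩
  · exact Nat.mul_pos (Nat.succ_pos L) (Nat.add_pos_right _ (Nat.pow_pos (by omega)))
  · calc L < (L + 1) * 1 := by omega
      _ ≤ (L + 1) * (m * M ^ n * m + b₀) := Nat.mul_le_mul_left _ hb₀pos
  · rw [hsc, hJ₀w]
  · rw [hsc]
    exact Nat.mul_le_mul_left _ (key J hJ).1
  · rw [hsc] at h
    exact (key J hJ).2 (Nat.eq_of_mul_eq_mul_left (Nat.succ_pos L) h)

/-! ### The ideal of the origin and the shape of the monomials of `𝔪²` -/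

variable (k : Type u) [Field k]

/-- `x_a · x_b` is the monomial with exponent `e_a + e_b`. [folklore] -/
private theorem X_mul_X_eq {n : ℕ} (a b : Fin n) :
    (X a * X b : MvPolynomial (Fin n) k) = monomial (Finsupp.single a 1 + Finsupp.single b 1) 1 := by
  change monomial (Finsupp.single a 1) (1 : k) * monomial (Finsupp.single b 1) 1 = _
  rw [monomial_mul, mul_one]

/-- «By assumption `C` is contained in `{J | ∑ j_i ≥ 2}`»: every monomial of an element of `𝔪²` is divisible by some
`x_a x_b`. [cite: FantechiManetti1998ObstructionCalculus, Lemma 5.6] -/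
theorem exists_le_of_mem_span_X_sq {n : ℕ} {f : MvPolynomial (Fin n) k}
    (hf : f ∈ Ideal.span (Set.range (X : Fin n → MvPolynomial (Fin n) k)) ^ 2)
    (J : Fin n →₀ ℕ) (hJ : J ∈ f.support) :
    ∃ a b : Fin n, Finsupp.single a 1 + Finsupp.single b 1 ≤ J := by
  have hsub : Set.range (X : Fin n → MvPolynomial (Fin n) k) * Set.range (X : Fin n → MvPolynomial (Fin n) k) ⊆
      (fun s => monomial s (1 : k)) '' {s | ∃ a b : Fin n, s = Finsupp.single a 1 + Finsupp.single b 1} := by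
    rintro p ⟨_, ⟨a, rfl⟩, _, ⟨b, rfl⟩, rfl⟩
    exact ⟨_, ⟨a, b, rfl⟩, (X_mul_X_eq k a b).symm⟩
  rw [pow_two, Ideal.span_mul_span'] at hf
  obtain ⟨si, ⟨a, b, rfl⟩, hle⟩ := mem_ideal_span_monomial_image.1 (Ideal.span_mono hsub hf) J hJ
  exact ⟨a, b, hle⟩

/-! ### Two ring-theoretic computations -/

/-- «As `I ⊂ 𝔪_P²`, `l_f` does not depend on the lifting chosen» ([FantechiManetti1998ObstructionCalculus, proof of
Lemma 5.2]): if `y_i ≡ z_i (mod K)`, all `y_i, z_i ∈ 𝔪` and `𝔪 · K = 0`, then `y^J = z^J` for every exponent `J`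
divisible by some `x_a x_b`. [cite: FantechiManetti1998ObstructionCalculus, Lemma 5.2] -/
theorem prod_pow_eq_of_sub_mem {S : Type*} [CommRing S] {n : ℕ} (𝔪 K : Ideal S)
    (hmK : ∀ x ∈ 𝔪, ∀ e ∈ K, x * e = 0) (y z : Fin n → S) (hy : ∀ i, y i ∈ 𝔪) (hz : ∀ i, z i ∈ 𝔪)
    (hyz : ∀ i, y i - z i ∈ K) (J : Fin n →₀ ℕ) (a b : Fin n)
    (hJ : Finsupp.single a 1 + Finsupp.single b 1 ≤ J) :
    (J.prod fun i e => y i ^ e) = J.prod fun i e => z i ^ e := by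
  obtain ⟨J', rfl⟩ : ∃ J', J = Finsupp.single a 1 + Finsupp.single b 1 + J' :=
    ⟨J - (Finsupp.single a 1 + Finsupp.single b 1), (add_tsub_cancel_of_le hJ).symm⟩
  have hsplit : ∀ w : Fin n → S, ((Finsupp.single a 1 + Finsupp.single b 1 + J').prod fun i e => w i ^ e) =
      w a * w b * J'.prod fun i e => w i ^ e := fun w => by
    rw [Finsupp.prod_add_index' (h := fun i e => w i ^ e) (fun _ => pow_zero _) (fun _ _ _ => pow_add _ _ _),
      Finsupp.prod_add_index' (h := fun i e => w i ^ e) (fun _ => pow_zero _) (fun _ _ _ => pow_add _ _ _),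
      Finsupp.prod_single_index (h := fun i e => w i ^ e) (pow_zero _),
      Finsupp.prod_single_index (h := fun i e => w i ^ e) (pow_zero _), pow_one, pow_one]
  rw [hsplit, hsplit]
  set Y := J'.prod fun i e => y i ^ e
  set Z := J'.prod fun i e => z i ^ e
  have htail : Y - Z ∈ K := by
    rw [← Ideal.Quotient.eq]
    simp only [Y, Z, Finsupp.prod, map_prod, map_pow]
    exact Finset.prod_congr rfl fun i _ => by rw [Ideal.Quotient.eq.2 (hyz i)]
  have h1 : y b * ((y a - z a) * Y) = 0 := hmK _ (hy b) _ (K.mul_mem_right _ (hyz a))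
  have h2 : z a * ((y b - z b) * Y) = 0 := hmK _ (hz a) _ (K.mul_mem_right _ (hyz b))
  have h3 : z a * (z b * (Y - Z)) = 0 := hmK _ (hz a) _ (K.mul_mem_left _ htail)
  rw [← sub_eq_zero]
  calc y a * y b * Y - z a * z b * Z
      = y b * ((y a - z a) * Y) + z a * ((y b - z b) * Y) + z a * (z b * (Y - Z)) := by ring
    _ = 0 := by rw [h1, h2, h3, add_zero, add_zero]

/-- The weighted curve on monomials: `x_i ↦ τ^{a_i}` sends `c · x^J` to `c · τ^{∑ a_i J_i}` («We have
`c(x^{J₀}) = t^B`, and `c(x^J) ∈ (t^{B+1})` for all `J ∈ C`, `J ≠ J₀`»). [cite: FantechiManetti1998ObstructionCalculus, Lemma 5.6] -/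
theorem aeval_pow_monomial {S : Type u} [CommRing S] [Algebra k S] (τ : S) {n : ℕ} (a : Fin n → ℕ)
    (J : Fin n →₀ ℕ) (c : k) :
    aeval (fun i => τ ^ a i) (monomial J c) = algebraMap k S c * τ ^ (∑ i, a i * J i) := by
  rw [aeval_monomial, Finsupp.prod_fintype _ _ (fun i => pow_zero _)]
  simp_rw [← pow_mul]
  rw [Finset.prod_pow_eq_pow_sum]

end T1Lifting

section Functors

variable (k : Type u) [Field k]

/-- (i) ⇒ (iii) of [FantechiManetti1998ObstructionCalculus, Lemma 5.6] («the functor `h_R` is smooth» when `R` is a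
power series algebra), polynomial form: the functor of points of `P = k[x_1, …, x_n]` lifts along every surjection
`R₁ → R₂` in `Art_k` (lift the images of the variables); [Schlessinger1968, Prop. 2.5 (i), p. 211]: «Conversely, if
`S` is a power series ring over `R`, then it is obvious that `h_S → h_R` is smooth.»
[cite: FantechiManetti1998ObstructionCalculus, Lemma 5.6] [cite: Schlessinger1968, Prop. 2.5 (i)] -/
theorem points_mvPolynomial_map_surjective {n : ℕ} {R₁ R₂ : ArtAlg.{u} k} (φ : R₁ →ₐ[k] R₂)
    (hφ : Function.Surjective φ) :
    Function.Surjective ((ArtinFunctor.points (k := k) (MvPolynomial (Fin n) k)).map (R := R₁) (S := R₂) φ) := by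
  intro (g : MvPolynomial (Fin n) k →ₐ[k] R₂)
  choose s hs using fun i => hφ (g (X i))
  refine ⟨aeval s, ?_⟩
  change φ.comp (aeval s) = g
  exact MvPolynomial.algHom_ext fun i => by simp [hs]

/-- **[FantechiManetti1998ObstructionCalculus, Lemma 5.6], (iii) ⇒ (i)**, algebraic presentations: let `k` be a field,
`P = k[x_1, …, x_n]`, `𝔪 = (x_1, …, x_n)`, `I ⊆ 𝔪²` an ideal, and let `h` be the functor of points of `P/I` on `Art_k`.
If there is an `N₀` such that `h(k[t]/t^{N+2}) → h(k[t]/t^{N+1})` (the map induced by `i : A_{N+1} → A_N`) is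
surjective for every `N ≥ N₀`, then `I = 0` (so `P/I = P` is a polynomial = «power series algebra» presentation and
`h` is smooth, `points_mvPolynomial_map_surjective`). Proof as printed (p. 561): weights `a_i` with a unique minimal
monomial `J₀` of `I` of weight `b = N + 1 > N₀` (`T1Lifting.exists_weights`); the curve `x_i ↦ t^{a_i}` kills `I` in
`A_N`, hence defines a point of `h(A_N)`; a lift `ψ` to `A_{N+1}` has `ψ(x_i) ≡ t^{a_i}` modulo `ker i = k·t^{N+1}`, so
(`I ⊆ 𝔪²`, `T1Lifting.prod_pow_eq_of_sub_mem`) `ψ(f) = (coefficient of x^{J₀} in f) · t^{N+1} ≠ 0` for an `f ∈ I`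
containing the monomial `x^{J₀}` — a contradiction. No hypothesis on `k` (any field).
[cite: FantechiManetti1998ObstructionCalculus, Lemma 5.6] -/
theorem ideal_eq_bot_of_points_map_i_surjective {n : ℕ} (I : Ideal (MvPolynomial (Fin n) k))
    (hI : I ≤ Ideal.span (Set.range (X : Fin n → MvPolynomial (Fin n) k)) ^ 2) (N₀ : ℕ)
    (hsurj : ∀ N, N₀ ≤ N → Function.Surjective
      ((ArtinFunctor.points (k := k) (MvPolynomial (Fin n) k ⧸ I)).map
        (R := T1Lifting.artA k (N + 1)) (S := T1Lifting.artA k N) (T1Lifting.i k N))) :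
    I = ⊥ := by
  by_contra hne
  obtain ⟨f, hfI, hf0⟩ : ∃ f ∈ I, f ≠ 0 := (Submodule.ne_bot_iff I).1 hne
  -- `C` = the exponents occurring in elements of `I`
  set C : Set (Fin n →₀ ℕ) := {J | ∃ g ∈ I, J ∈ g.support} with hC
  have hCne : C.Nonempty := by
    obtain ⟨J, hJ⟩ := Finset.nonempty_iff_ne_empty.2 (mt MvPolynomial.support_eq_empty.1 hf0)
    exact ⟨J, f, hfI, hJ⟩
  have hC2 : ∀ J ∈ C, ∃ a b : Fin n, Finsupp.single a 1 + Finsupp.single b 1 ≤ J :=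
    fun J ⟨g, hg, hJ⟩ => T1Lifting.exists_le_of_mem_span_X_sq k (hI hg) J hJ
  have hC0 : (0 : Fin n →₀ ℕ) ∉ C := fun h => by
    obtain ⟨a, b, hle⟩ := hC2 0 h
    have := Finsupp.le_def.1 hle a
    simp [Finsupp.single_apply] at this
  -- the weights, with minimal weight `N + 1 > N₀` attained only at `J₀ ∈ support f₀`, `f₀ ∈ I`
  obtain ⟨a, b, J₀, ⟨f₀, hf₀I, hJ₀f₀⟩, ha1, hLb, hJ₀b, hkey⟩ := T1Lifting.exists_weights C hCne hC0 N₀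
  obtain ⟨N, rfl⟩ : ∃ N, b = N + 1 := ⟨b - 1, by omega⟩
  have hN : N₀ ≤ N := by omega
  -- the weighted curve `c_N : P → A_N`, `x_i ↦ t^{a_i}`, kills `I`
  set cN : MvPolynomial (Fin n) k →ₐ[k] T1Lifting.A k N := aeval fun i => T1Lifting.t k N ^ a i with hcN_def
  have hcN : ∀ g, g ∈ I → cN g = 0 := by
    intro g hg
    rw [g.as_sum, map_sum]
    refine Finset.sum_eq_zero fun J hJ => ?_
    rw [hcN_def, T1Lifting.aeval_pow_monomial,
      T1Lifting.t_pow_eq_zero_of_lt k (Nat.lt_of_succ_le (hkey J ⟨g, hg, hJ⟩).1), mul_zero]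
  -- it descends to `R = P/I` and lifts to `A_{N+1}` by hypothesis
  set cR : (MvPolynomial (Fin n) k ⧸ I) →ₐ[k] T1Lifting.A k N := Ideal.Quotient.liftₐ I cN hcN with hcR_def
  obtain ⟨(ψ : (MvPolynomial (Fin n) k ⧸ I) →ₐ[k] T1Lifting.A k (N + 1)), hψ⟩ := hsurj N hN cR
  have hψ' : (T1Lifting.i k N).comp ψ = cR := hψ
  set Ψ : MvPolynomial (Fin n) k →ₐ[k] T1Lifting.A k (N + 1) := ψ.comp (Ideal.Quotient.mkₐ k I) with hΨ_def
  set y : Fin n → T1Lifting.A k (N + 1) := fun i => Ψ (X i) with hy_def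
  set z : Fin n → T1Lifting.A k (N + 1) := fun i => T1Lifting.t k (N + 1) ^ a i with hz_def
  have hΨ : Ψ = aeval y := aeval_unique Ψ
  -- `y_i ≡ z_i = t^{a_i}` modulo `K = ker i = (t^{N+1})`, and both lie in `𝔪 = (t)`, `𝔪 K = 0`
  have hiy : ∀ i, T1Lifting.i k N (y i) = T1Lifting.t k N ^ a i := fun i =>
    calc T1Lifting.i k N (y i) = ((T1Lifting.i k N).comp ψ) (Ideal.Quotient.mkₐ k I (X i)) := rfl
      _ = cR (Ideal.Quotient.mkₐ k I (X i)) := by rw [hψ']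
      _ = cN (X i) := AlgHom.congr_fun (Ideal.Quotient.liftₐ_comp I cN hcN) (X i)
      _ = T1Lifting.t k N ^ a i := by rw [hcN_def, aeval_X]
  set K : Ideal (T1Lifting.A k (N + 1)) := Ideal.span {T1Lifting.t k (N + 1) ^ (N + 1)} with hK
  set 𝔪 : Ideal (T1Lifting.A k (N + 1)) := Ideal.span {T1Lifting.t k (N + 1)} with h𝔪
  have hKm : K ≤ 𝔪 :=
    Ideal.span_singleton_le_span_singleton.2 (dvd_pow_self _ (Nat.succ_ne_zero N))
  have hmK : ∀ x ∈ 𝔪, ∀ e ∈ K, x * e = 0 := by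
    intro x hx e he
    obtain ⟨u, rfl⟩ := Ideal.mem_span_singleton'.1 hx
    obtain ⟨v, rfl⟩ := Ideal.mem_span_singleton'.1 he
    calc u * T1Lifting.t k (N + 1) * (v * T1Lifting.t k (N + 1) ^ (N + 1))
        = u * v * T1Lifting.t k (N + 1) ^ (N + 1 + 1) := by ring
      _ = 0 := by rw [T1Lifting.t_pow_succ, mul_zero]
  have hyz : ∀ i, y i - z i ∈ K := fun i => by
    have h0 : T1Lifting.i k N (y i - z i) = 0 := by
      rw [map_sub, hiy, hz_def, map_pow, T1Lifting.i_t, sub_self]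
    obtain ⟨c, hc⟩ := T1Lifting.exists_eq_smul_of_i_eq_zero k N h0
    rw [hc, Algebra.smul_def]
    exact K.mul_mem_left _ (Ideal.subset_span rfl)
  have hz : ∀ i, z i ∈ 𝔪 := fun i =>
    Ideal.mem_span_singleton'.2 ⟨T1Lifting.t k (N + 1) ^ (a i - 1), by
      rw [hz_def, ← pow_succ, Nat.sub_add_cancel (ha1 i)]⟩
  have hy : ∀ i, y i ∈ 𝔪 := fun i => by
    have := 𝔪.add_mem (hKm (hyz i)) (hz i)
    rwa [sub_add_cancel] at this
  -- hence `Ψ = aeval y` agrees with `aeval z` (the curve `x_i ↦ t^{a_i}` into `A_{N+1}`) on `I ⊆ 𝔪²`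
  have hagree : ∀ g ∈ I, aeval y g = aeval z g := fun g hg => by
    conv_lhs => rw [g.as_sum]
    conv_rhs => rw [g.as_sum]
    rw [map_sum, map_sum]
    exact Finset.sum_congr rfl fun J hJ => by
      obtain ⟨a', b', hab⟩ := hC2 J ⟨g, hg, hJ⟩
      rw [aeval_monomial, aeval_monomial, T1Lifting.prod_pow_eq_of_sub_mem 𝔪 K hmK y z hy hz hyz J a' b' hab]
  -- `aeval z (f₀) = coeff_{J₀}(f₀) · t^{N+1} ≠ 0`
  have hzf₀ : aeval z f₀ = algebraMap k _ (coeff J₀ f₀) * T1Lifting.t k (N + 1) ^ (N + 1) := by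
    conv_lhs => rw [f₀.as_sum]
    rw [map_sum, Finset.sum_eq_single J₀]
    · rw [hz_def, T1Lifting.aeval_pow_monomial, hJ₀b]
    · intro J hJ hJne
      have h1 := hkey J ⟨f₀, hf₀I, hJ⟩
      have hlt : N + 1 < ∑ i, a i * J i := lt_of_le_of_ne h1.1 fun h => hJne (h1.2 h.symm)
      rw [hz_def, T1Lifting.aeval_pow_monomial, T1Lifting.t_pow_eq_zero_of_lt k hlt, mul_zero]
    · exact fun h => absurd hJ₀f₀ h
  -- but `Ψ(f₀) = ψ(0) = 0`
  have hΨf₀ : Ψ f₀ = 0 := by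
    change ψ (Ideal.Quotient.mkₐ k I f₀) = 0
    rw [Ideal.Quotient.mkₐ_eq_mk, Ideal.Quotient.eq_zero_iff_mem.2 hf₀I, map_zero]
  have hzero : algebraMap k _ (coeff J₀ f₀) * T1Lifting.t k (N + 1) ^ (N + 1) = 0 := by
    rw [← hzf₀, ← hagree f₀ hf₀I, ← hΨ]
    exact hΨf₀
  have hunit : IsUnit (algebraMap k (T1Lifting.A k (N + 1)) (coeff J₀ f₀)) :=
    (Ne.isUnit (mem_support_iff.1 hJ₀f₀)).map _
  exact T1Lifting.t_pow_ne_zero k (N + 1) ((hunit.mul_right_eq_zero).1 hzero)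

/-- **Kawamata's T¹-lifting theorem for pro-representable functors** ([Kawamata1992UnobstructedDeformations, Thm. 1]
as reported in [FantechiManetti1999T1Lifting, p. 1, l. 20–24]: «In [Kaw1] Kawamata extended the definition of
T¹-lifting to an arbitrary functor, and proved theorem A under the additional assumption that `F` be
prorepresentable», Theorem A being «Let `F` be a deformation functor. If `F` satisfies the T¹-lifting condition and
`char k = 0`, then `F` is smooth.»), ALGEBRAIC PRESENTATIONS: let `k` be a field of characteristic zero,
`P = k[x_1, …, x_n]`, `I ⊆ (x_1, …, x_n)²` an ideal. If the functor of points of `P/I` on `Art_k` has the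
T¹-lifting property ([FantechiManetti1999T1Lifting, Def. 1.1]), then `I = 0`. Proof = the tree's (H4) case of the
T¹-lifting theorem (`ArtinFunctor.map_i_succ_surjective_of_t1Lifting`: `h(A_{m+1}) → h(A_m)` onto for all `m ≥ 1`;
the functor of points has (H4), `ArtinFunctor.points_H4`) followed by [FantechiManetti1998ObstructionCalculus,
Lemma 5.6] (iii) ⇒ (i) with `N₀ = 1` («Arguing as in [Kaw1] it is sufficient to prove that for every integer `m ≥ 1`
`F(A_{m+1}) → F(A_m)` is surjective», [FantechiManetti1999T1Lifting, p. 3, l. 3–4]).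
[cite: FantechiManetti1999T1Lifting, Thm. A] -/
theorem ideal_eq_bot_of_t1Lifting [CharZero k] {n : ℕ} (I : Ideal (MvPolynomial (Fin n) k))
    (hI : I ≤ Ideal.span (Set.range (X : Fin n → MvPolynomial (Fin n) k)) ^ 2)
    (hT : (ArtinFunctor.points (k := k) (MvPolynomial (Fin n) k ⧸ I)).T1Lifting) : I = ⊥ :=
  ideal_eq_bot_of_points_map_i_surjective k I hI 1 fun N hN => by
    obtain ⟨m, rfl⟩ : ∃ m, N = m + 1 := ⟨N - 1, by omega⟩
    exact ArtinFunctor.map_i_succ_surjective_of_t1Lifting _ (ArtinFunctor.points_H4 _) hT m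

end Functors

/-! ## The printed setting: `P = k[[x_1, …, x_n]]`

[FantechiManetti1998ObstructionCalculus, Lemma 5.6] is printed for `R ∈ Ârt_k` written as `R = P/I`,
`P = k[[x_1, …, x_n]]` the ring of FORMAL power series, `I ⊂ 𝔪_P²` (p. 561, and Lemma 5.2 (ii) p. 559). The same
weight argument works verbatim once two facts about `P` in finitely many variables are in place: (a) the weighted
curve `x_i ↦ t^{a_i}` extends to a `k`-algebra map `P → A_N` (through the total-degree truncation
`MvPowerSeries.truncTotal (N+1)`, the monomials of degree `> N` dying in `A_N`); (b) a `k`-algebra map `Ψ : P → A`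
with `Ψ(x_i) ∈ 𝔪`, `𝔪^M = 0`, kills every series without monomials of degree `< M` (such a series is a finite sum
`∑_{|d| = M} x^d h_d`), so `Ψ` is computed on the polynomial truncation. -/

section PowerSeries

namespace T1Lifting

variable (k : Type u) [Field k]

/-- An exponent of degree `≥ 2` dominates some `e_a + e_b`. [folklore] -/
private theorem exists_single_add_single_le {n : ℕ} (e : Fin n →₀ ℕ) (he : 2 ≤ e.degree) :
    ∃ a b : Fin n, Finsupp.single a 1 + Finsupp.single b 1 ≤ e := by
  have he0 : e ≠ 0 := fun h => by simp [h] at he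
  obtain ⟨a, ha⟩ : ∃ a, e a ≠ 0 := DFunLike.ne_iff.1 he0
  have hae : Finsupp.single a 1 ≤ e := Finsupp.single_le_iff.2 (Nat.one_le_iff_ne_zero.2 ha)
  set e' := e - Finsupp.single a 1 with he'
  have hee' : e = Finsupp.single a 1 + e' := by rw [he', add_tsub_cancel_of_le hae]
  have he'0 : e' ≠ 0 := by
    intro h
    rw [hee', h, add_zero, Finsupp.degree_single] at he
    omega
  obtain ⟨b, hb⟩ : ∃ b, e' b ≠ 0 := DFunLike.ne_iff.1 he'0
  refine ⟨a, b, ?_⟩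
  rw [hee']
  exact add_le_add le_rfl (Finsupp.single_le_iff.2 (Nat.one_le_iff_ne_zero.2 hb))

/-- An exponent of degree `≥ M` dominates an exponent of degree exactly `M`. [folklore] -/
private theorem exists_le_degree_eq {n : ℕ} : ∀ (M : ℕ) (e : Fin n →₀ ℕ), M ≤ e.degree → ∃ d ≤ e, d.degree = M
  | 0, _, _ => ⟨0, bot_le, by simp⟩
  | M + 1, e, h => by
    obtain ⟨d, hde, hdM⟩ := exists_le_degree_eq M e (by omega)
    have hne : d ≠ e := fun hde' => by rw [hde'] at hdM; omega
    have hlt : ∃ i, d i < e i := by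
      by_contra hcon
      exact hne (le_antisymm hde (Finsupp.le_def.2 fun i => not_lt.1 fun hi => hcon ⟨i, hi⟩))
    obtain ⟨i, hi⟩ := hlt
    refine ⟨d + Finsupp.single i 1, Finsupp.le_def.2 fun j => ?_, by rw [map_add, hdM, Finsupp.degree_single]⟩
    have hdj := Finsupp.le_def.1 hde j
    by_cases hj : j = i
    · subst hj
      simp only [Finsupp.coe_add, Pi.add_apply, Finsupp.single_eq_same]
      omega
    · simp only [Finsupp.coe_add, Pi.add_apply, Finsupp.single_apply, if_neg (Ne.symm hj), add_zero]
      exact hdj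

/-- «To give a local morphism from `P = k[[x_1, …, x_n]]` to `S ∈ Ârt_k` is equivalent to choosing `f_1, …, f_n ∈ 𝔪_S`
and requiring that `x_i ↦ f_i`» ([FantechiManetti1998ObstructionCalculus, proof of Lemma 5.2, p. 559]) rests on the
finiteness of the set of variables through the decomposition proved here: a formal power series in finitely many
variables with no monomials of degree `< M` is a finite sum `∑_{|d| = M} x^d · h_d` (so it lies in `(x_1, …, x_n)^M`).
[cite: FantechiManetti1998ObstructionCalculus, Lemma 5.2] -/
theorem exists_eq_sum_monomial_mul {n : ℕ} (M : ℕ) (g : MvPowerSeries (Fin n) k)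
    (hg : ∀ e : Fin n →₀ ℕ, e.degree < M → MvPowerSeries.coeff e g = 0) :
    ∃ (D : Finset (Fin n →₀ ℕ)) (h : (Fin n →₀ ℕ) → MvPowerSeries (Fin n) k),
      (∀ d ∈ D, d.degree = M) ∧ g = ∑ d ∈ D, MvPowerSeries.monomial d (1 : k) * h d := by
  classical
  have hsel : ∀ e : Fin n →₀ ℕ, ∃ d : Fin n →₀ ℕ, M ≤ e.degree → d ≤ e ∧ d.degree = M := fun e => by
    by_cases h : M ≤ e.degree
    · obtain ⟨d, hd, hdM⟩ := exists_le_degree_eq M e h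
      exact ⟨d, fun _ => ⟨hd, hdM⟩⟩
    · exact ⟨0, fun h' => absurd h' h⟩
  choose sel hsel using hsel
  set D : Finset (Fin n →₀ ℕ) := (Finsupp.finite_of_degree_eq (σ := Fin n) M).toFinset with hD
  have hmemD : ∀ d, d ∈ D ↔ d.degree = M := fun d => by rw [hD, Set.Finite.mem_toFinset]; rfl
  let h : (Fin n →₀ ℕ) → MvPowerSeries (Fin n) k := fun d c =>
    if M ≤ (c + d).degree ∧ sel (c + d) = d then MvPowerSeries.coeff (c + d) g else 0
  have hcoeff : ∀ d c, MvPowerSeries.coeff c (h d) =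
      if M ≤ (c + d).degree ∧ sel (c + d) = d then MvPowerSeries.coeff (c + d) g else 0 := fun d c => rfl
  refine ⟨D, h, fun d hd => (hmemD d).1 hd, ?_⟩
  ext e
  rw [map_sum]
  simp only [MvPowerSeries.coeff_monomial_mul, one_mul]
  by_cases hM : M ≤ e.degree
  · obtain ⟨hsel1, hsel2⟩ := hsel e hM
    rw [Finset.sum_eq_single (sel e)]
    · rw [if_pos hsel1, hcoeff, tsub_add_cancel_of_le hsel1, if_pos ⟨hM, rfl⟩]
    · intro d _ hdne
      by_cases hde : d ≤ e
      · rw [if_pos hde, hcoeff, tsub_add_cancel_of_le hde, if_neg (fun h2 => hdne h2.2.symm)]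
      · rw [if_neg hde]
    · exact fun hnot => absurd ((hmemD _).2 hsel2) hnot
  · rw [hg e (not_le.1 hM)]
    refine (Finset.sum_eq_zero fun d hd => ?_).symm
    rw [if_neg]
    intro hde
    have h1 := (hmemD d).1 hd
    have h2 : d.degree ≤ e.degree := by
      rw [Finsupp.degree_eq_sum, Finsupp.degree_eq_sum]
      exact Finset.sum_le_sum fun i _ => Finsupp.le_def.1 hde i
    omega

/-- The uniqueness half of «to give a local morphism from `P = k[[x_1, …, x_n]]` to `S ∈ Ârt_k` is equivalent to
choosing `f_1, …, f_n ∈ 𝔪_S` and requiring that `x_i ↦ f_i`» ([FantechiManetti1998ObstructionCalculus, proof of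
Lemma 5.2, p. 559]), in the form used below: a `k`-algebra map `Ψ : k[[x_1, …, x_n]] → S` whose values on the variables
lie in an ideal `𝔪` with `𝔪^M = 0` kills every series without monomials of degree `< M`, so `Ψ` is determined on the
polynomial truncation below degree `M` by the `Ψ(x_i)`. [cite: FantechiManetti1998ObstructionCalculus, Lemma 5.2] -/
theorem algHom_eq_zero_of_coeff_eq_zero {n : ℕ} {S : Type u} [CommRing S] [Algebra k S]
    (Ψ : MvPowerSeries (Fin n) k →ₐ[k] S) (𝔪 : Ideal S) (M : ℕ) (h𝔪 : 𝔪 ^ M = ⊥)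
    (hy : ∀ i, Ψ (MvPowerSeries.X i) ∈ 𝔪) (g : MvPowerSeries (Fin n) k)
    (hg : ∀ e : Fin n →₀ ℕ, e.degree < M → MvPowerSeries.coeff e g = 0) : Ψ g = 0 := by
  classical
  obtain ⟨D, h, hD, rfl⟩ := exists_eq_sum_monomial_mul k M g hg
  rw [map_sum]
  refine Finset.sum_eq_zero fun d hd => ?_
  rw [map_mul]
  suffices hmon : Ψ (MvPowerSeries.monomial d (1 : k)) = 0 by rw [hmon, zero_mul]
  rw [MvPowerSeries.monomial_one_eq, map_finsuppProd]
  simp_rw [map_pow]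
  have hmem : (d.prod fun i e => Ψ (MvPowerSeries.X i) ^ e) ∈ 𝔪 ^ d.degree := by
    rw [Finsupp.prod, Finsupp.degree_apply, ← Finset.prod_pow_eq_pow_sum]
    exact Ideal.prod_mem_prod fun i _ => Ideal.pow_mem_pow (hy i) _
  rw [hD d hd, h𝔪] at hmem
  exact (Submodule.mem_bot S).1 hmem

/-- The degree of an exponent is bounded by any weight with weights `≥ 1`. [folklore] -/
private theorem degree_le_weight {n : ℕ} (a : Fin n → ℕ) (ha : ∀ i, 1 ≤ a i) (J : Fin n →₀ ℕ) :
    J.degree ≤ ∑ i, a i * J i := by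
  rw [Finsupp.degree_eq_sum]
  exact Finset.sum_le_sum fun i _ => Nat.le_mul_of_pos_left _ (ha i)

/-- THE WEIGHTED CURVE on formal power series («Define `c : P → k[[t]]` by requiring `c(x_i) = t^{A_i}` … Therefore `c`
induces an element `f ∈ h_R(k[[t]]/t^B)`», [FantechiManetti1998ObstructionCalculus, proof of Lemma 5.6]): for
weights `a_i ≥ 1` there is a `k`-algebra map `k[[x_1, …, x_n]] → A_N = k[t]/(t^{N+1})` which is `x_i ↦ t^{a_i}` on the
polynomial truncation below degree `N + 1` (monomials of degree `> N` have weight `> N` and die in `A_N`).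
[cite: FantechiManetti1998ObstructionCalculus, Lemma 5.6] -/
theorem exists_curve {n : ℕ} (N : ℕ) (a : Fin n → ℕ) (ha : ∀ i, 1 ≤ a i) :
    ∃ c : MvPowerSeries (Fin n) k →ₐ[k] A k N,
      ∀ f, c f = aeval (fun i => t k N ^ a i) (MvPowerSeries.truncTotal (N + 1) f) := by
  have hkill : ∀ p : MvPolynomial (Fin n) k, (∀ x : Fin n →₀ ℕ, x.degree < N + 1 → coeff x p = 0) →
      aeval (fun i => t k N ^ a i) p = 0 := fun p hp => by
    rw [p.as_sum, map_sum]
    refine Finset.sum_eq_zero fun x hx => ?_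
    have hxN : N + 1 ≤ x.degree := not_lt.1 fun hlt => (mem_support_iff.1 hx) (hp x hlt)
    rw [aeval_pow_monomial, t_pow_eq_zero_of_lt k (Nat.lt_of_succ_le (le_trans hxN (degree_le_weight a ha x))),
      mul_zero]
  let l : MvPowerSeries (Fin n) k →ₗ[k] A k N :=
    (aeval (R := k) fun i => t k N ^ a i).toLinearMap.comp (MvPowerSeries.truncTotal (N + 1))
  have hl : ∀ f, l f = aeval (fun i => t k N ^ a i) (MvPowerSeries.truncTotal (N + 1) f) := fun f => rfl
  refine ⟨AlgHom.ofLinearMap l ?_ ?_, fun f => rfl⟩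
  · rw [hl, MvPowerSeries.truncTotal_one (Nat.succ_ne_zero N), map_one]
  · intro f g
    rw [hl, hl, hl, ← map_mul, ← sub_eq_zero, ← map_sub]
    refine hkill _ fun x hx => ?_
    rw [coeff_sub, MvPowerSeries.coeff_truncTotal _ hx,
      MvPowerSeries.coeff_truncTotal_mul_truncTotal_eq_coeff_mul _ _ hx, sub_self]

/-- «To give a local morphism from `P = k[[x_1, …, x_n]]` to `S ∈ Ârt_k` is equivalent to choosing `f_1, …, f_n ∈ 𝔪_S`
and requiring that `x_i ↦ f_i`» ([FantechiManetti1998ObstructionCalculus, proof of Lemma 5.2, p. 559]) — and EVERY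
`k`-algebra map `Ψ : P → S` into an object `S` of `Art_k` is local: `Ψ(x_i) ∈ 𝔪_S` (if `Ψ(x_i)` were a unit with
residue `λ ≠ 0`, the unit `x_i − λ` of `P` would map to `Ψ(x_i) − λ`, which the augmentation kills). Hence for
`R = P/I` the functor of points `ArtinFunctor.points R` of the tree IS Schlessinger's `h_R = Hom_{Ârt_k}(R, −)`.
[cite: FantechiManetti1998ObstructionCalculus, Lemma 5.2] -/
theorem algHom_X_mem_maximalIdeal {n : ℕ} (S : ArtAlg.{u} k) (Ψ : MvPowerSeries (Fin n) k →ₐ[k] S)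
    (i : Fin n) : Ψ (MvPowerSeries.X i) ∈ IsLocalRing.maximalIdeal S := by
  obtain ⟨aug⟩ := S.exists_augmentation
  rw [IsLocalRing.mem_maximalIdeal, mem_nonunits_iff]
  intro hu
  have hl : IsUnit (aug (Ψ (MvPowerSeries.X i))) := hu.map aug
  have hP : IsUnit (MvPowerSeries.X i - MvPowerSeries.C (aug (Ψ (MvPowerSeries.X i))) : MvPowerSeries (Fin n) k) := by
    rw [MvPowerSeries.isUnit_iff_constantCoeff, map_sub, MvPowerSeries.constantCoeff_X, MvPowerSeries.constantCoeff_C,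
      zero_sub, IsUnit.neg_iff]
    exact hl
  have h2 := (hP.map Ψ).map aug
  rw [map_sub, map_sub, MvPowerSeries.c_eq_algebraMap, AlgHom.commutes, AlgHom.commutes, Algebra.algebraMap_self,
    RingHom.id_apply, sub_self] at h2
  exact not_isUnit_zero h2

/-- In an object of `Art_k` the maximal ideal is nilpotent: `𝔪_S^M = 0` for some `M ≥ 1` (Artinian local). [folklore] -/
private theorem exists_maximalIdeal_pow_eq_bot (S : ArtAlg.{u} k) :
    ∃ M : ℕ, 1 ≤ M ∧ IsLocalRing.maximalIdeal S ^ M = ⊥ := by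
  obtain ⟨M, hM⟩ := IsArtinianRing.isNilpotent_jacobson_bot (R := S)
  rw [IsLocalRing.jacobson_eq_maximalIdeal ⊥ bot_ne_top] at hM
  refine ⟨M + 1, Nat.le_add_left 1 M, le_bot_iff.1 ?_⟩
  calc IsLocalRing.maximalIdeal S ^ (M + 1) ≤ IsLocalRing.maximalIdeal S ^ M := Ideal.pow_le_pow_right (Nat.le_succ M)
    _ = ⊥ := hM

/-- A `k`-algebra map out of `k[[x_1, …, x_n]]` restricted to polynomials is the evaluation at its values on the
variables. [cite: FantechiManetti1998ObstructionCalculus, Lemma 5.2] -/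
theorem algHom_coe_eq_aeval {n : ℕ} {S : Type u} [CommRing S] [Algebra k S]
    (Ψ : MvPowerSeries (Fin n) k →ₐ[k] S) (p : MvPolynomial (Fin n) k) :
    Ψ (↑p) = aeval (fun i => Ψ (MvPowerSeries.X i)) p := by
  induction p using MvPolynomial.induction_on with
  | C c => rw [MvPolynomial.coe_C, algHom_C, MvPowerSeries.c_eq_algebraMap, AlgHom.commutes]
  | add p q hp hq => rw [MvPolynomial.coe_add, map_add, map_add, hp, hq]
  | mul_X p i hp => rw [MvPolynomial.coe_mul, MvPolynomial.coe_X, map_mul, map_mul, hp, aeval_X]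

/-- UNIQUENESS in «to give a local morphism from `P = k[[x_1, …, x_n]]` to `S ∈ Ârt_k` is equivalent to choosing
`f_1, …, f_n ∈ 𝔪_S` and requiring that `x_i ↦ f_i`» ([FantechiManetti1998ObstructionCalculus, proof of Lemma 5.2,
p. 559]), for `S ∈ Art_k`: two `k`-algebra maps `k[[x_1, …, x_n]] → S` that agree on the variables are equal.
[cite: FantechiManetti1998ObstructionCalculus, Lemma 5.2] -/
theorem mvPowerSeries_algHom_ext {n : ℕ} (S : ArtAlg.{u} k) (Φ Ψ : MvPowerSeries (Fin n) k →ₐ[k] S)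
    (h : ∀ i, Φ (MvPowerSeries.X i) = Ψ (MvPowerSeries.X i)) : Φ = Ψ := by
  classical
  obtain ⟨M, -, hM⟩ := exists_maximalIdeal_pow_eq_bot k S
  have htr : ∀ (Θ : MvPowerSeries (Fin n) k →ₐ[k] S) (f : MvPowerSeries (Fin n) k),
      Θ f = Θ ↑(MvPowerSeries.truncTotal M f) := fun Θ f => by
    rw [← sub_eq_zero, ← map_sub]
    refine algHom_eq_zero_of_coeff_eq_zero k Θ (IsLocalRing.maximalIdeal S) M hM
      (fun i => algHom_X_mem_maximalIdeal k S Θ i) _ fun e he => ?_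
    rw [map_sub, MvPolynomial.coeff_coe, MvPowerSeries.coeff_truncTotal _ he, sub_self]
  refine AlgHom.ext fun f => ?_
  rw [htr Φ, htr Ψ, algHom_coe_eq_aeval, algHom_coe_eq_aeval]
  exact congrArg (fun v : Fin n → S => aeval v (MvPowerSeries.truncTotal M f)) (funext h)

/-- EXISTENCE half of «to give a local morphism from `P = k[[x_1, …, x_n]]` to `S ∈ Ârt_k` is equivalent to choosing
`f_1, …, f_n ∈ 𝔪_S` and requiring that `x_i ↦ f_i`» ([FantechiManetti1998ObstructionCalculus, proof of Lemma 5.2,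
p. 559]): for `f_1, …, f_n` in an ideal `𝔪` of a `k`-algebra `S` with `𝔪^M = 0` there is a
`k`-algebra map `k[[x_1, …, x_n]] → S` with `x_i ↦ f_i`, computed on the polynomial truncation below degree `M + 1`
(monomials of degree `≥ M` in the `f_i` vanish; `M ≥ 1`). [cite: FantechiManetti1998ObstructionCalculus, Lemma 5.2] -/
theorem exists_algHom_of_pow_eq_bot {n : ℕ} {S : Type u} [CommRing S] [Algebra k S] (𝔪 : Ideal S) (M : ℕ)
    (hM1 : 1 ≤ M) (hM : 𝔪 ^ M = ⊥) (f : Fin n → S) (hf : ∀ i, f i ∈ 𝔪) :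
    ∃ Ψ : MvPowerSeries (Fin n) k →ₐ[k] S,
      (∀ g, Ψ g = aeval f (MvPowerSeries.truncTotal (M + 1) g)) ∧ ∀ i, Ψ (MvPowerSeries.X i) = f i := by
  classical
  have hkill : ∀ p : MvPolynomial (Fin n) k, (∀ x : Fin n →₀ ℕ, x.degree < M + 1 → coeff x p = 0) →
      aeval f p = 0 := fun p hp => by
    rw [p.as_sum, map_sum]
    refine Finset.sum_eq_zero fun x hx => ?_
    have hxM : M + 1 ≤ x.degree := not_lt.1 fun hlt => (mem_support_iff.1 hx) (hp x hlt)
    rw [aeval_monomial]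
    have hmem : (x.prod fun i e => f i ^ e) ∈ 𝔪 ^ x.degree := by
      rw [Finsupp.prod, Finsupp.degree_apply, ← Finset.prod_pow_eq_pow_sum]
      exact Ideal.prod_mem_prod fun i _ => Ideal.pow_mem_pow (hf i) _
    have h0 : (x.prod fun i e => f i ^ e) = 0 := by
      have := Ideal.pow_le_pow_right (le_trans (Nat.le_succ M) hxM) hmem
      rwa [hM, Submodule.mem_bot] at this
    rw [h0, mul_zero]
  let l : MvPowerSeries (Fin n) k →ₗ[k] S := (aeval (R := k) f).toLinearMap.comp (MvPowerSeries.truncTotal (M + 1))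
  have hl : ∀ g, l g = aeval f (MvPowerSeries.truncTotal (M + 1) g) := fun g => rfl
  refine ⟨AlgHom.ofLinearMap l ?_ ?_, fun g => rfl, fun i => ?_⟩
  · rw [hl, MvPowerSeries.truncTotal_one (Nat.succ_ne_zero M), map_one]
  · intro g g'
    rw [hl, hl, hl, ← map_mul, ← sub_eq_zero, ← map_sub]
    refine hkill _ fun x hx => ?_
    rw [coeff_sub, MvPowerSeries.coeff_truncTotal _ hx,
      MvPowerSeries.coeff_truncTotal_mul_truncTotal_eq_coeff_mul _ _ hx, sub_self]
  · change l (MvPowerSeries.X i) = f i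
    rw [hl, ← MvPolynomial.coe_X, (MvPowerSeries.truncTotal_coe_eq_self_iff _ (Nat.succ_ne_zero M)).2
      (by rw [totalDegree_X]; omega), aeval_X]

/-- «`I ⊂ 𝔪_P²`» read on coefficients: an element of the square of the maximal ideal of `k[[x_1, …, x_n]]` has order
`≥ 2` (no constant or linear monomials). [cite: FantechiManetti1998ObstructionCalculus, Lemma 5.2] -/
theorem two_le_order_of_mem_maximalIdeal_sq {n : ℕ} {f : MvPowerSeries (Fin n) k}
    (hf : f ∈ (IsLocalRing.maximalIdeal (MvPowerSeries (Fin n) k)) ^ 2) : (2 : ℕ∞) ≤ f.order := by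
  have hmem : ∀ u ∈ IsLocalRing.maximalIdeal (MvPowerSeries (Fin n) k), (1 : ℕ∞) ≤ u.order := by
    intro u hu
    rw [MvPowerSeries.one_le_order_iff_constCoeff_eq_zero]
    have hu' := (IsLocalRing.mem_maximalIdeal _).1 hu
    rw [mem_nonunits_iff, MvPowerSeries.isUnit_iff_constantCoeff, isUnit_iff_ne_zero, not_not] at hu'
    exact hu'
  rw [pow_two] at hf
  refine Submodule.mul_induction_on hf (fun u hu v hv => ?_) (fun x y hx hy => ?_)
  · calc (2 : ℕ∞) = 1 + 1 := one_add_one_eq_two.symm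
      _ ≤ u.order + v.order := add_le_add (hmem u hu) (hmem v hv)
      _ ≤ (u * v).order := MvPowerSeries.le_order_mul
  · exact le_trans (le_min hx hy) MvPowerSeries.min_order_le_add

end T1Lifting

variable (k : Type u) [Field k]

/-- (i) ⇒ «the functor `h_R` is smooth» of [FantechiManetti1998ObstructionCalculus, Lemma 5.6] in the printed setting:
the functor of points of the power series ring `P = k[[x_1, …, x_n]]` lifts along every surjection `R₁ → R₂` of
`Art_k` — lift the images of the variables (they stay in the maximal ideal), evaluate (`T1Lifting.exists_algHom_of_pow_eq_bot`,
the maximal ideal of `R₁` being nilpotent) and compare on the variables (`T1Lifting.mvPowerSeries_algHom_ext`);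
[Schlessinger1968, Prop. 2.5 (i), p. 211]: «Conversely, if `S` is a power series ring over `R`, then it is obvious
that `h_S → h_R` is smooth.» [cite: FantechiManetti1998ObstructionCalculus, Lemma 5.6]
[cite: Schlessinger1968, Prop. 2.5 (i)] -/
theorem points_mvPowerSeries_map_surjective {n : ℕ} {R₁ R₂ : ArtAlg.{u} k} (φ : R₁ →ₐ[k] R₂)
    (hφ : Function.Surjective φ) :
    Function.Surjective ((ArtinFunctor.points (k := k) (MvPowerSeries (Fin n) k)).map (R := R₁) (S := R₂) φ) := by
  intro (g : MvPowerSeries (Fin n) k →ₐ[k] R₂)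
  choose s hs using fun i => hφ (g (MvPowerSeries.X i))
  have hsm : ∀ i, s i ∈ IsLocalRing.maximalIdeal R₁ := fun i => by
    rw [IsLocalRing.mem_maximalIdeal, mem_nonunits_iff]
    intro hu
    have hu2 : IsUnit (g (MvPowerSeries.X i)) := hs i ▸ hu.map φ
    exact (IsLocalRing.mem_maximalIdeal _).1 (T1Lifting.algHom_X_mem_maximalIdeal k R₂ g i) hu2
  obtain ⟨M, hM1, hM⟩ := T1Lifting.exists_maximalIdeal_pow_eq_bot k R₁
  obtain ⟨G, -, hG⟩ := T1Lifting.exists_algHom_of_pow_eq_bot k (IsLocalRing.maximalIdeal R₁) M hM1 hM s hsm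
  refine ⟨G, ?_⟩
  change φ.comp G = g
  exact T1Lifting.mvPowerSeries_algHom_ext k R₂ _ _ fun i => by rw [AlgHom.comp_apply, hG, hs]

/-- **[FantechiManetti1998ObstructionCalculus, Lemma 5.6], (iii) ⇒ (i), as printed** («Write `R = P/I`, with
`P = k[[x_1, …, x_n]]` and `I ⊂ 𝔪_P²`. Assume `I ≠ 0` …»): let `k` be any field, `P = k[[x_1, …, x_n]]`, `I ⊆ 𝔪_P²` an
ideal (`𝔪_P` the maximal ideal), `R = P/I`, and `h_R` the functor of points of `R` on `Art_k` (`ArtinFunctor.points`;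
Schlessinger's `h_R`). If there is an `N₀` such that `h_R(k[t]/t^{N+2}) → h_R(k[t]/t^{N+1})` is surjective for every
`N ≥ N₀`, then `I = 0`, i.e. «`R` is a power series algebra» and `h_R` is smooth. Proof as printed (p. 561, see the
module docstring), through `T1Lifting.exists_weights`, the curve `T1Lifting.exists_curve`, the lift-independence
`T1Lifting.prod_pow_eq_of_sub_mem` and `T1Lifting.algHom_eq_zero_of_coeff_eq_zero` (a `k`-algebra map `P → A_{N+1}`
is computed on the truncation below degree `N + 2`). (Every `R ∈ Ârt_k` — a complete local Noetherian `k`-algebra with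
residue field `k` — is of this form by Cohen's structure theorem; that identification is not formalised here.)
[cite: FantechiManetti1998ObstructionCalculus, Lemma 5.6] -/
theorem powerSeries_ideal_eq_bot_of_points_map_i_surjective {n : ℕ} (I : Ideal (MvPowerSeries (Fin n) k))
    (hI : I ≤ (IsLocalRing.maximalIdeal (MvPowerSeries (Fin n) k)) ^ 2) (N₀ : ℕ)
    (hsurj : ∀ N, N₀ ≤ N → Function.Surjective
      ((ArtinFunctor.points (k := k) (MvPowerSeries (Fin n) k ⧸ I)).map
        (R := T1Lifting.artA k (N + 1)) (S := T1Lifting.artA k N) (T1Lifting.i k N))) :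
    I = ⊥ := by
  classical
  by_contra hne
  obtain ⟨f, hfI, hf0⟩ : ∃ f ∈ I, f ≠ 0 := (Submodule.ne_bot_iff I).1 hne
  -- `C` = the exponents occurring in elements of `I`; all have degree ≥ 2 since `I ⊆ 𝔪²`
  set C : Set (Fin n →₀ ℕ) := {J | ∃ g ∈ I, MvPowerSeries.coeff J g ≠ 0} with hC
  have hCne : C.Nonempty := by
    obtain ⟨J, hJ⟩ := (MvPowerSeries.ne_zero_iff_exists_coeff_ne_zero f).1 hf0
    exact ⟨J, f, hfI, hJ⟩
  have hord : ∀ g ∈ I, ∀ J, MvPowerSeries.coeff J g ≠ 0 → 2 ≤ J.degree := fun g hg J hJ => by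
    by_contra hlt
    refine hJ (MvPowerSeries.coeff_of_lt_order ?_)
    exact lt_of_lt_of_le (by exact_mod_cast not_le.1 hlt) (T1Lifting.two_le_order_of_mem_maximalIdeal_sq k (hI hg))
  have hC2 : ∀ J ∈ C, ∃ a b : Fin n, Finsupp.single a 1 + Finsupp.single b 1 ≤ J :=
    fun J ⟨g, hg, hJ⟩ => T1Lifting.exists_single_add_single_le J (hord g hg J hJ)
  have hC0 : (0 : Fin n →₀ ℕ) ∉ C := fun ⟨g, hg, hJ⟩ => by
    have := hord g hg 0 hJ
    simp at this
  -- the weights, with minimal weight `N + 1`, `N ≥ max N₀ 1`, attained only at `J₀`, a monomial of `f₀ ∈ I`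
  obtain ⟨a, b, J₀, ⟨f₀, hf₀I, hJ₀f₀⟩, ha1, hLb, hJ₀b, hkey⟩ := T1Lifting.exists_weights C hCne hC0 (max N₀ 1)
  obtain ⟨N, rfl⟩ : ∃ N, b = N + 1 := ⟨b - 1, by omega⟩
  have hN : N₀ ≤ N := by have := le_max_left N₀ 1; omega
  have hN1 : 1 ≤ N := by have := le_max_right N₀ 1; omega
  have hdegw := T1Lifting.degree_le_weight a ha1
  -- the weighted curve `c_N : P → A_N` kills `I`
  obtain ⟨cN, hcN_def⟩ := T1Lifting.exists_curve k N a ha1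
  have hsupp : ∀ (g : MvPowerSeries (Fin n) k) (M : ℕ) (J : Fin n →₀ ℕ),
      J ∈ (MvPowerSeries.truncTotal M g).support → MvPowerSeries.coeff J g ≠ 0 ∧ J.degree < M := by
    intro g M J hJ
    have h1 := mem_support_iff.1 hJ
    rw [MvPowerSeries.coeff_truncTotal_eq_ite] at h1
    by_cases hdeg : J.degree < M
    · rw [if_pos hdeg] at h1
      exact ⟨h1, hdeg⟩
    · rw [if_neg hdeg] at h1
      exact absurd rfl h1
  have hcN : ∀ g, g ∈ I → cN g = 0 := fun g hg => by
    rw [hcN_def, (MvPowerSeries.truncTotal (N + 1) g).as_sum, map_sum]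
    refine Finset.sum_eq_zero fun J hJ => ?_
    rw [T1Lifting.aeval_pow_monomial,
      T1Lifting.t_pow_eq_zero_of_lt k (Nat.lt_of_succ_le (hkey J ⟨g, hg, (hsupp g _ J hJ).1⟩).1), mul_zero]
  -- it descends to `R = P/I` and lifts to `A_{N+1}` by hypothesis
  set cR : (MvPowerSeries (Fin n) k ⧸ I) →ₐ[k] T1Lifting.A k N := Ideal.Quotient.liftₐ I cN hcN with hcR_def
  obtain ⟨(ψ : (MvPowerSeries (Fin n) k ⧸ I) →ₐ[k] T1Lifting.A k (N + 1)), hψ⟩ := hsurj N hN cR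
  have hψ' : (T1Lifting.i k N).comp ψ = cR := hψ
  set Ψ : MvPowerSeries (Fin n) k →ₐ[k] T1Lifting.A k (N + 1) := ψ.comp (Ideal.Quotient.mkₐ k I) with hΨ_def
  set y : Fin n → T1Lifting.A k (N + 1) := fun i => Ψ (MvPowerSeries.X i) with hy_def
  set z : Fin n → T1Lifting.A k (N + 1) := fun i => T1Lifting.t k (N + 1) ^ a i with hz_def
  -- `y_i ≡ z_i = t^{a_i}` modulo `K = ker i = (t^{N+1})`, and both lie in `𝔪 = (t)`, `𝔪 K = 0`, `𝔪^{N+2} = 0`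
  have hiy : ∀ i, T1Lifting.i k N (y i) = T1Lifting.t k N ^ a i := fun i =>
    calc T1Lifting.i k N (y i) = ((T1Lifting.i k N).comp ψ) (Ideal.Quotient.mkₐ k I (MvPowerSeries.X i)) := rfl
      _ = cR (Ideal.Quotient.mkₐ k I (MvPowerSeries.X i)) := by rw [hψ']
      _ = cN (MvPowerSeries.X i) := AlgHom.congr_fun (Ideal.Quotient.liftₐ_comp I cN hcN) (MvPowerSeries.X i)
      _ = aeval (fun i => T1Lifting.t k N ^ a i) (MvPowerSeries.truncTotal (N + 1) (MvPowerSeries.X i)) :=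
          hcN_def _
      _ = T1Lifting.t k N ^ a i := by
          rw [← MvPolynomial.coe_X, (MvPowerSeries.truncTotal_coe_eq_self_iff _ (Nat.succ_ne_zero N)).2
            (by rw [totalDegree_X]; omega), aeval_X]
  set K : Ideal (T1Lifting.A k (N + 1)) := Ideal.span {T1Lifting.t k (N + 1) ^ (N + 1)} with hK
  set 𝔪 : Ideal (T1Lifting.A k (N + 1)) := Ideal.span {T1Lifting.t k (N + 1)} with h𝔪
  have hKm : K ≤ 𝔪 :=
    Ideal.span_singleton_le_span_singleton.2 (dvd_pow_self _ (Nat.succ_ne_zero N))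
  have hmK : ∀ x ∈ 𝔪, ∀ e ∈ K, x * e = 0 := by
    intro x hx e he
    obtain ⟨u, rfl⟩ := Ideal.mem_span_singleton'.1 hx
    obtain ⟨v, rfl⟩ := Ideal.mem_span_singleton'.1 he
    calc u * T1Lifting.t k (N + 1) * (v * T1Lifting.t k (N + 1) ^ (N + 1))
        = u * v * T1Lifting.t k (N + 1) ^ (N + 1 + 1) := by ring
      _ = 0 := by rw [T1Lifting.t_pow_succ, mul_zero]
  have h𝔪pow : 𝔪 ^ (N + 2) = ⊥ := by
    rw [h𝔪, Ideal.span_singleton_pow, Ideal.span_singleton_eq_bot]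
    exact T1Lifting.t_pow_succ k (N + 1)
  have hyz : ∀ i, y i - z i ∈ K := fun i => by
    have h0 : T1Lifting.i k N (y i - z i) = 0 := by
      rw [map_sub, hiy, hz_def, map_pow, T1Lifting.i_t, sub_self]
    obtain ⟨c, hc⟩ := T1Lifting.exists_eq_smul_of_i_eq_zero k N h0
    rw [hc, Algebra.smul_def]
    exact K.mul_mem_left _ (Ideal.subset_span rfl)
  have hz : ∀ i, z i ∈ 𝔪 := fun i =>
    Ideal.mem_span_singleton'.2 ⟨T1Lifting.t k (N + 1) ^ (a i - 1), by
      rw [hz_def, ← pow_succ, Nat.sub_add_cancel (ha1 i)]⟩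
  have hy : ∀ i, y i ∈ 𝔪 := fun i => by
    have := 𝔪.add_mem (hKm (hyz i)) (hz i)
    rwa [sub_add_cancel] at this
  -- `Ψ` is computed on the truncation below degree `N + 2`, where it is `aeval y`, which agrees with `aeval z` on `I`
  have hΨpoly : ∀ p : MvPolynomial (Fin n) k, Ψ (↑p) = aeval y p := fun p => by
    induction p using MvPolynomial.induction_on with
    | C c =>
      rw [MvPolynomial.coe_C, algHom_C, MvPowerSeries.c_eq_algebraMap, AlgHom.commutes]
    | add p q hp hq => rw [MvPolynomial.coe_add, map_add, map_add, hp, hq]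
    | mul_X p i hp => rw [MvPolynomial.coe_mul, MvPolynomial.coe_X, map_mul, map_mul, hp, aeval_X]
  have hΨtrunc : ∀ g, Ψ g = Ψ ↑(MvPowerSeries.truncTotal (N + 2) g) := fun g => by
    rw [← sub_eq_zero, ← map_sub]
    refine T1Lifting.algHom_eq_zero_of_coeff_eq_zero k Ψ 𝔪 (N + 2) h𝔪pow hy _ fun e he => ?_
    rw [map_sub, MvPolynomial.coeff_coe, MvPowerSeries.coeff_truncTotal _ he, sub_self]
  have hagree : ∀ g ∈ I, Ψ g = aeval z (MvPowerSeries.truncTotal (N + 2) g) := fun g hg => by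
    rw [hΨtrunc g, hΨpoly, (MvPowerSeries.truncTotal (N + 2) g).as_sum, map_sum, map_sum]
    refine Finset.sum_congr rfl fun J hJ => ?_
    obtain ⟨a', b', hab⟩ := hC2 J ⟨g, hg, (hsupp g _ J hJ).1⟩
    rw [aeval_monomial, aeval_monomial, T1Lifting.prod_pow_eq_of_sub_mem 𝔪 K hmK y z hy hz hyz J a' b' hab]
  -- `aeval z (trunc f₀) = coeff_{J₀}(f₀) · t^{N+1} ≠ 0`
  have hJ₀deg : J₀.degree < N + 2 := by have := hdegw J₀; omega
  have hzf₀ : aeval z (MvPowerSeries.truncTotal (N + 2) f₀) =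
      algebraMap k _ (MvPowerSeries.coeff J₀ f₀) * T1Lifting.t k (N + 1) ^ (N + 1) := by
    rw [(MvPowerSeries.truncTotal (N + 2) f₀).as_sum, map_sum, Finset.sum_eq_single J₀]
    · rw [hz_def, T1Lifting.aeval_pow_monomial, hJ₀b, MvPowerSeries.coeff_truncTotal _ hJ₀deg]
    · intro J hJ hJne
      have h1 := hkey J ⟨f₀, hf₀I, (hsupp f₀ _ J hJ).1⟩
      have hlt : N + 1 < ∑ i, a i * J i := lt_of_le_of_ne h1.1 fun h => hJne (h1.2 h.symm)
      rw [hz_def, T1Lifting.aeval_pow_monomial, T1Lifting.t_pow_eq_zero_of_lt k hlt, mul_zero]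
    · intro hnot
      exfalso
      apply hnot
      rw [mem_support_iff, MvPowerSeries.coeff_truncTotal _ hJ₀deg]
      exact hJ₀f₀
  -- but `Ψ(f₀) = ψ(0) = 0`
  have hΨf₀ : Ψ f₀ = 0 := by
    change ψ (Ideal.Quotient.mkₐ k I f₀) = 0
    rw [Ideal.Quotient.mkₐ_eq_mk, Ideal.Quotient.eq_zero_iff_mem.2 hf₀I, map_zero]
  have hzero : algebraMap k _ (MvPowerSeries.coeff J₀ f₀) * T1Lifting.t k (N + 1) ^ (N + 1) = 0 := by
    rw [← hzf₀, ← hagree f₀ hf₀I]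
    exact hΨf₀
  have hunit : IsUnit (algebraMap k (T1Lifting.A k (N + 1)) (MvPowerSeries.coeff J₀ f₀)) :=
    (Ne.isUnit hJ₀f₀).map _
  exact T1Lifting.t_pow_ne_zero k (N + 1) ((hunit.mul_right_eq_zero).1 hzero)

/-- **[FantechiManetti1998ObstructionCalculus, Lemma 5.6], (i) ⟺ (iii)** («the following are equivalent»), printed
setting, with (i) read as `I = 0` for `R = k[[x_1, …, x_n]]/I`, `I ⊆ 𝔪_P²`: `I = 0` iff there is an `N₀` such that
`h_R(A_{N+1}) → h_R(A_N)` is surjective for all `N ≥ N₀` ((i) ⇒ (iii): `points_mvPowerSeries_map_surjective`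
transported through `P/0 = P`; (iii) ⇒ (i): `powerSeries_ideal_eq_bot_of_points_map_i_surjective`). (ii), «no
curvilinear obstructions», is not typed here. [cite: FantechiManetti1998ObstructionCalculus, Lemma 5.6] -/
theorem powerSeries_ideal_eq_bot_iff_points_map_i_surjective {n : ℕ} (I : Ideal (MvPowerSeries (Fin n) k))
    (hI : I ≤ (IsLocalRing.maximalIdeal (MvPowerSeries (Fin n) k)) ^ 2) :
    I = ⊥ ↔ ∃ N₀ : ℕ, ∀ N, N₀ ≤ N → Function.Surjective
      ((ArtinFunctor.points (k := k) (MvPowerSeries (Fin n) k ⧸ I)).map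
        (R := T1Lifting.artA k (N + 1)) (S := T1Lifting.artA k N) (T1Lifting.i k N)) := by
  constructor
  · rintro rfl
    refine ⟨0, fun N _ => ?_⟩
    intro (g : (MvPowerSeries (Fin n) k ⧸ (⊥ : Ideal (MvPowerSeries (Fin n) k))) →ₐ[k] T1Lifting.A k N)
    obtain ⟨(G : MvPowerSeries (Fin n) k →ₐ[k] T1Lifting.A k (N + 1)), hG⟩ :=
      points_mvPowerSeries_map_surjective k (R₁ := T1Lifting.artA k (N + 1)) (R₂ := T1Lifting.artA k N)
        (T1Lifting.i k N) (T1Lifting.i_surjective k N) (g.comp (Ideal.Quotient.mkₐ k ⊥))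
    have hG' : (T1Lifting.i k N).comp G = g.comp (Ideal.Quotient.mkₐ k ⊥) := hG
    refine ⟨Ideal.Quotient.liftₐ ⊥ G (fun a ha => by rw [(Submodule.mem_bot _).1 ha, map_zero]), ?_⟩
    change (T1Lifting.i k N).comp (Ideal.Quotient.liftₐ ⊥ G _) = g
    refine Ideal.Quotient.algHom_ext k ?_
    rw [AlgHom.comp_assoc, Ideal.Quotient.liftₐ_comp]
    exact hG'
  · rintro ⟨N₀, h⟩
    exact powerSeries_ideal_eq_bot_of_points_map_i_surjective k I hI N₀ h

/-- **[Schlessinger1968, Prop. 2.5 (i)] for presented rings** (Trans. AMS 130, p. 211: «Let `R → S` be a morphism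
in `Ĉ`. Then `h_S → h_R` is smooth if and only if `S` is a power series ring over `R`.»; smoothness as in
[Schlessinger1968, Def. 2.2, p. 210]: `F(B) → F(A) ×_{G(A)} G(B)` onto for every surjection `B → A` — for `G = h_k`
the one-point functor this says `F(B) → F(A)` onto), at `R = k` and for a PRESENTED `S = P/I`,
`P = k[[x_1, …, x_n]]`, `I ⊆ 𝔪_P²`, with «`S` is a power series ring» read as `I = 0` (as
[FantechiManetti1998ObstructionCalculus, Lemma 5.6] does: «(i) the functor `h_R` is smooth (hence `R` is a power
series algebra)», «Assume `I ≠ 0`, that is, (i) does not hold»): `I = 0` iff `h_{P/I}(R₁) → h_{P/I}(R₂)` is onto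
for every surjection `R₁ → R₂` of `Art_k`. (⇒: `points_mvPowerSeries_map_surjective` transported through
`P/0 = P`; ⇐: already the curvilinear surjections `A_{N+1} → A_N` suffice —
`powerSeries_ideal_eq_bot_of_points_map_i_surjective`, i.e. [FantechiManetti1998ObstructionCalculus, Lemma 5.6].)
[cite: Schlessinger1968, Prop. 2.5 (i)] [cite: FantechiManetti1998ObstructionCalculus, Lemma 5.6] -/
theorem powerSeries_ideal_eq_bot_iff_points_smooth {n : ℕ} (I : Ideal (MvPowerSeries (Fin n) k))
    (hI : I ≤ (IsLocalRing.maximalIdeal (MvPowerSeries (Fin n) k)) ^ 2) :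
    I = ⊥ ↔ ∀ (R₁ R₂ : ArtAlg.{u} k) (φ : R₁ →ₐ[k] R₂), Function.Surjective φ →
      Function.Surjective ((ArtinFunctor.points (k := k) (MvPowerSeries (Fin n) k ⧸ I)).map
        (R := R₁) (S := R₂) φ) := by
  constructor
  · rintro rfl R₁ R₂ φ hφ
    intro (g : (MvPowerSeries (Fin n) k ⧸ (⊥ : Ideal (MvPowerSeries (Fin n) k))) →ₐ[k] R₂)
    obtain ⟨(G : MvPowerSeries (Fin n) k →ₐ[k] R₁), hG⟩ :=
      points_mvPowerSeries_map_surjective k (R₁ := R₁) (R₂ := R₂) φ hφ (g.comp (Ideal.Quotient.mkₐ k ⊥))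
    have hG' : φ.comp G = g.comp (Ideal.Quotient.mkₐ k ⊥) := hG
    refine ⟨Ideal.Quotient.liftₐ ⊥ G (fun a ha => by rw [(Submodule.mem_bot _).1 ha, map_zero]), ?_⟩
    change φ.comp (Ideal.Quotient.liftₐ ⊥ G _) = g
    refine Ideal.Quotient.algHom_ext k ?_
    rw [AlgHom.comp_assoc, Ideal.Quotient.liftₐ_comp]
    exact hG'
  · intro h
    exact powerSeries_ideal_eq_bot_of_points_map_i_surjective k I hI 0 fun N _ =>
      h (T1Lifting.artA k (N + 1)) (T1Lifting.artA k N) (T1Lifting.i k N) (T1Lifting.i_surjective k N)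

/-- **Kawamata's T¹-lifting theorem for pro-representable functors `h_R`, `R = k[[x_1, …, x_n]]/I`**
([Kawamata1992UnobstructedDeformations, Thm. 1] as reported in [FantechiManetti1999T1Lifting, p. 1, l. 20–24]:
Theorem A — «Let `F` be a deformation functor. If `F` satisfies the T¹-lifting condition and `char k = 0`, then `F` is
smooth.» — «proved … under the additional assumption that `F` be prorepresentable»): let `k` be a field of
characteristic zero, `P = k[[x_1, …, x_n]]`, `I ⊆ 𝔪_P²` an ideal. If the functor of points of `P/I` on `Art_k` has the
T¹-lifting property ([FantechiManetti1999T1Lifting, Def. 1.1]), then `I = 0` («`R` is a power series algebra», i.e.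
`h_R` is smooth). Proof = the tree's (H4) case of the T¹-lifting theorem (`ArtinFunctor.map_i_succ_surjective_of_t1Lifting`,
with (H4) from `ArtinFunctor.points_H4`) and [FantechiManetti1998ObstructionCalculus, Lemma 5.6] (iii) ⇒ (i)
(`powerSeries_ideal_eq_bot_of_points_map_i_surjective`) with `N₀ = 1`, exactly as [FantechiManetti1999T1Lifting, p. 3,
l. 3–4] argues («Arguing as in [Kaw1] it is sufficient to prove that for every integer `m ≥ 1` `F(A_{m+1}) → F(A_m)` is
surjective»). [cite: FantechiManetti1999T1Lifting, Thm. A] -/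
theorem powerSeries_ideal_eq_bot_of_t1Lifting [CharZero k] {n : ℕ} (I : Ideal (MvPowerSeries (Fin n) k))
    (hI : I ≤ (IsLocalRing.maximalIdeal (MvPowerSeries (Fin n) k)) ^ 2)
    (hT : (ArtinFunctor.points (k := k) (MvPowerSeries (Fin n) k ⧸ I)).T1Lifting) : I = ⊥ :=
  powerSeries_ideal_eq_bot_of_points_map_i_surjective k I hI 1 fun N hN => by
    obtain ⟨m, rfl⟩ : ∃ m, N = m + 1 := ⟨N - 1, by omega⟩
    exact ArtinFunctor.map_i_succ_surjective_of_t1Lifting _ (ArtinFunctor.points_H4 _) hT m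

end PowerSeries

end Literature.AlgebraicGeometry.Deformation
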